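import Summits.ABC.IUTFork.Cor312ProvKRamifiedLabel
import Summits.ABC.IUTFork.Cor312ProvKChosenQIdeleNorm
import Literature.IUT.LogVolume.UnitLogValuationProfileShell
import HarnessLib

/-!
# IUT RESCUE-H (D-0079 «local-height condition I06⋆ / Rmk 3.12.2»), seat abc-iut-rp-d4 — `EvalI06StarShape`: the
# SHAPE column of I06⋆ at print's own `K`-level pilot datum — the three-valued decision of «q̲_w ∈ q̲_w^{j²}·ℐ_w»
# for the CHOSEN realising q-idele, from the valuation profile of `log_p(𝒪^×_{K_w})`

PROOF-ONLY cells file (D-0012; 0 definitions, 0 `Prop` facts; inputs consumed BY NAME) of the abc-iut cell, IUT REPAIR /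
RESCUE-H branch (rung LADDER-ABC:A2.RESCUE-H; R-H lead abc-iut-rh-lead, START-HERE v1 §1/§2: per cell (datum, bad `w ∣ p`,
label `j`) the honest reading of RP-I06⋆ `Repair.CandInternal11Gap.HQShellOrbitStar` is the local membership «`q̲_w ∈ q̲_w^{j²}·ℐ_w`»,
decided POS below `κ⁻ = c − a_e`, NEG above `κ⁺ = b_e + c`, SHAPE-OPEN in between; RE-ARM row «rp-d4 → REAL column of I06⋆ per
stratum: κ^idx / SHAPE-OPEN cells → deciding decls»).  TAKES NO SIDE on [IUTchIII] Cor. 3.12 or on any author; candidates are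
hypotheses; typed ≠ proved; refuted-AS-TYPED ≠ refuted-in-print.

THE DATUM.  `X := pilotDataOfK D K` (abc-iut-C-cert-3, `Cor312ProvK`), the `K`-level Dupuy–Hilado pilot datum of a collection of
initial Θ-data `D` ([IUTchI] Def. 3.1); a BAD fibre point `x₀ ∣ p` (`placeOf X p x₀ ∈ X.S`, place `w`); the completion
`K_w = kOf X p x₀` (abc-iut-S7's rescaled completion, an MLF); the CHOSEN realising q-idele `q := (exists_realising_qIdeles_pilotDataOfK D).choose p x₀ ∈ K_w`
(norm-specified ONLY: `‖q‖ = p^{ord_w(j_E)/(2l·e_w)}`, abc-iut-w4-d026 `norm_chosenQIdele_eq_rpow_ord_jE`).  STRATUM (tree, by name): `p ≠ 2`,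
`p ≠ l` (`ne_two_and_ne_l_of_placeOf_mem_S_pilotDataOfK`), `l ≤ e_w` (`l_le_absRamificationIdx_kOf_pilotDataOfK`), `2l ∣ ord_w(q)`
(`twoMulLDvdOrdq_pilotDataOfK`), `p ∣ disc K` (`caseA_hypotheses_unsat_pilotDataOfK`): EVERY row of the `pilotDataOfK` family is «ram-odd»,
so `c = ord_p(p*) = 1` and only the odd-`p` profile is needed.

THE SHAPE COLUMN (this file; `m := ord_w(q)/(2l) ∈ ℕ`, `e := e(K_w/ℚ_p)`, `t := e − (n−1)·m` the `ϖ`-exponent of `p·q^{1−n}`):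
* §1 `norm_chosenQIdele_eq_unif_zpow` — `‖q‖ = ‖ϖ‖ᵐ` for every norm uniformizer `ϖ` of `K_w` (the bridge from C-cert's idele normalisation
  to the profile files); `pstar_exponent_eq_one` (`c = 1`).
* §2 the cells, from `Literature.IUT.LogVolume.ValuationProfile` (abc-iut-rp-d4, `UnitLogValuationProfile{,Shell}`):
  **POS** `chosenQIdele_mem_pow_smul_logShell_of_lt` — `e < t·(p−1)` ⟹ `q ∈ qⁿ·ℐ_w` (every `e`; SHARP inner radius `⌊e/(p−1)⌋+1 ≤ ⌈e/(p−2)⌉ = e·a_e`);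
  **NEG (gap)** `chosenQIdele_not_mem_pow_smul_logShell_of_gap` — `(p−1) ∤ e` and `t` in a gap `h_s(a₀) < t < ν(s+1)` of the profile ⟹ `q ∉ qⁿ·ℐ_w`;
  **NEG (floor)** `chosenQIdele_not_mem_pow_smul_logShell_of_lt_min` — `t < ν(1)` ⟹ `q ∉ qⁿ·ℐ_w` (every `e`; sharp form of `κ⁺`);
  **OPEN** `shapeOpen_witnesses` — at `t = ν(s)` with `a₀ ≥ 1` the sphere of `K_w` of exponent `t` meets `log_p(𝒪^×_{K_w})` properly: the cell is NOT
  decided by the norm of the chosen idele (honest SHAPE-OPEN; finer invariants of the true `q̲_w = q_E^{1/2l}` would be needed).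
* §3 `stratum_row` — the type column packaged: `p ≠ 2 ∧ p ≠ l ∧ l ≤ e ∧ 2l ∣ ord_w(q) ∧ p ∣ disc K`.
HOW A TABLE WRITER USES IT (integer arithmetic only): compute `e`, `m`, `t = e − (j²−1)m`; POS iff `e < t(p−1)`; else, if `(p−1) ∤ e`, list
`ν(s) = s·p^{a₀(s)} − e·a₀(s)` for `s = 1 … ⌊e/(p−1)⌋` (`a₀(s)` = least `a` with `e < s·pᵃ·(p−1)`): NEG iff `t ∉ {ν(s)}` (cite the gap or floor
theorem with the bracketing `s`), OPEN iff `t = ν(s)` for some such `s`.  `(p−1) ∣ e_w` rows: POS/floor-NEG still apply; the rest waits for the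
boundary profile (`UnitLogBoundaryRamification*`, ζ_p-dependence).
HONEST SCOPE: statements about OUR typed objects (the real log-shell of [AbsTopIII] Def. 5.4 (iii) at the completion, the chosen idele of
the typed datum); the I06⋆ reading is the R-H START-HERE §1 honest reading, NOT a claim about print's (Ind3); nothing here bears on the
truth of [IUTchIII] Cor. 3.12.  [cite: NeukirchANT1999, Ch. II Prop. (5.5)] [cite: MochizukiAbsTopIII2015, Def 5.4 (iii) p. 126]
[cite: Mochizuki2012, IUTchI Def. 3.1 (b)(c) pp. 61–62, Ex. 3.2 (iv) p. 71] [cite: DupuyHilado2025, §3.3, §3.4] [claim: Mochizuki2012, status: disputed]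
for every IUT locution.
-/

noncomputable section

open Set Function NumberField IsDedekindDomain Metric
open scoped Pointwise

namespace Summit.ABC.IUTFork.Repair.EvalI06StarShape

open Literature.IUT.LogVolume Literature.IUT.HodgeTheaters Literature.IUT.LogVolume.ValuationProfile
  Literature.NumberTheory.GaloisRepresentations.Ultrametric Literature.AnabelianGeometry.AbsoluteAnabelian
  Thm311 Thm311.Real Cor312Prov

variable {F K Fbar : Type} [Field F] [NumberField F] [Field K] [NumberField K] [Algebra F K] [Field Fbar]
  [Algebra F Fbar] [Algebra K Fbar] {E : WeierstrassCurve F} [E.IsElliptic] {l : ℕ} {Pb : BadPlacePredicates K}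
  (D : InitialThetaData F K Fbar E l Pb)

/-! ## §1. The bridge: the chosen q-idele has norm `‖ϖ‖ᵐ`, `m = ord_w(q)/(2l)`; and `c = 1` -/

/-- **`2l ∣ ord_w(q)` at a bad fibre point** ([IUTchI] Ex. 3.2 (iv), abc-iut-C-cert-3's `twoMulLDvdOrdq_pilotDataOfK` read at `w = placeOf X p x₀`).
[cite: Mochizuki2012, IUTchI Ex. 3.2 (iv) p. 71] -/
theorem two_mul_l_dvd_ordq_placeOf (pp : Nat.Primes) (x₀ : (thetaIndex (pilotDataOfK D K)).Fibre (.inr pp))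
    (hx : haveI : Fact (pp : ℕ).Prime := ⟨pp.2⟩; placeOf (pilotDataOfK D K) pp.1 x₀ ∈ (pilotDataOfK D K).S) :
    haveI : Fact (pp : ℕ).Prime := ⟨pp.2⟩
    (2 * (l : ℤ)) ∣ (pilotDataOfK D K).ordq (placeOf (pilotDataOfK D K) pp.1 x₀) := by
  haveI : Fact (pp : ℕ).Prime := ⟨pp.2⟩
  have h := twoMulLDvdOrdq_pilotDataOfK D _ hx
  rwa [pilotDataOfK_l] at h

/-- **THE BRIDGE.** For every norm uniformizer `ϖ` of `K_w = kOf X p x₀` at a bad fibre point: the CHOSEN realising q-idele has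
`‖q‖ = ‖ϖ‖^{ord_w(q)/(2l)}` — from `‖q‖ = p^{ord_w(j_E)/(2l·e_w)}` (abc-iut-w4-d026), `ord_w(q) = −ord_w(j_E)`, `2l ∣ ord_w(q)`, and
`‖ϖ‖ = p^{−1/e_w}` with `e_w = ramIdx K w = e(K_w/ℚ_p)` (abc-iut-S7 `absRamificationIdx_rescaledCompletion`, `ramIdx_eq`).
[cite: DupuyHilado2025, §3.3, §3.4] [cite: NeukirchANT1999, Ch. II Prop. (5.5)] -/
theorem norm_chosenQIdele_eq_unif_zpow (pp : Nat.Primes) (x₀ : (thetaIndex (pilotDataOfK D K)).Fibre (.inr pp))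
    (hx : haveI : Fact (pp : ℕ).Prime := ⟨pp.2⟩; placeOf (pilotDataOfK D K) pp.1 x₀ ∈ (pilotDataOfK D K).S)
    {ϖ : (haveI : Fact (pp : ℕ).Prime := ⟨pp.2⟩; kOf (pilotDataOfK D K) pp.1 x₀)ˣ}
    (hϖ : haveI : Fact (pp : ℕ).Prime := ⟨pp.2⟩; IsUniformizer ϖ) :
    haveI : Fact (pp : ℕ).Prime := ⟨pp.2⟩
    ‖(exists_realising_qIdeles_pilotDataOfK D).choose pp x₀‖ =
      ‖(ϖ : kOf (pilotDataOfK D K) pp.1 x₀)‖ ^ ((pilotDataOfK D K).ordq (placeOf (pilotDataOfK D K) pp.1 x₀) / (2 * (l : ℤ))) := by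
  haveI : Fact (pp : ℕ).Prime := ⟨pp.2⟩
  obtain ⟨m, hm⟩ := two_mul_l_dvd_ordq_placeOf D pp x₀ hx
  have hl0 : (2 * (l : ℤ)) ≠ 0 := by
    have := D.five_le_l
    omega
  rw [hm, Int.mul_ediv_cancel_left _ hl0, RamificationCriterion.norm_unif_zpow_eq_rpow (pp : ℕ) hϖ m,
    norm_chosenQIdele_eq_rpow_ord_jE D pp x₀ hx]
  congr 1
  -- `e(K_w/ℚ_p) = ramIdx K w` (abc-iut-S7's identification, through Mathlib's `ramificationIdx ℤ`)
  have he : (absRamificationIdx (pp : ℕ) (kOf (pilotDataOfK D K) pp.1 x₀) : ℝ) =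
      (ramIdx K (placeOf (pilotDataOfK D K) pp.1 x₀) : ℝ) := by
    rw [ramIdx_eq, ← absRamificationIdx_rescaledCompletion K (pp : ℕ) (placeOf (pilotDataOfK D K) pp.1 x₀)
      (natCast_mem_placeOf (pilotDataOfK D K) pp.1 x₀)]
  -- `ord_w(j_E) = −ord_w(q) = −2l·m`
  have hord : (ord K (placeOf (pilotDataOfK D K) pp.1 x₀) (algebraMap F K E.j) : ℝ) = -(2 * (l : ℝ) * (m : ℝ)) := by
    have h1 : ((pilotDataOfK D K).ordq (placeOf (pilotDataOfK D K) pp.1 x₀) : ℝ) =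
        -(ord K (placeOf (pilotDataOfK D K) pp.1 x₀) (algebraMap F K E.j) : ℝ) := by
      unfold PilotData.ordq
      rw [show (pilotDataOfK D K).jE = algebraMap F K E.j from rfl]
      push_cast
      ring
    have h2 : ((pilotDataOfK D K).ordq (placeOf (pilotDataOfK D K) pp.1 x₀) : ℝ) = 2 * (l : ℝ) * (m : ℝ) := by
      rw [hm]
      push_cast
      ring
    linarith
  have hl : (l : ℝ) ≠ 0 := by
    have := D.five_le_l
    exact_mod_cast (show l ≠ 0 by omega)
  have he0 : (ramIdx K (placeOf (pilotDataOfK D K) pp.1 x₀) : ℝ) ≠ 0 := by exact_mod_cast ramIdx_ne_zero K _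
  rw [he, hord]
  field_simp

/-- **`c = ord_p(p*) = 1` at every bad fibre point** (`p ≠ 2`, [IUTchI] Def. 3.1 (b) «odd residue characteristic»,
abc-iut-w5-d054's `ne_two_and_ne_l_of_placeOf_mem_S_pilotDataOfK`). [cite: Mochizuki2012, IUTchI Def. 3.1 (b) p. 61] -/
theorem pstar_exponent_eq_one (pp : Nat.Primes) (x₀ : (thetaIndex (pilotDataOfK D K)).Fibre (.inr pp))
    (hx : haveI : Fact (pp : ℕ).Prime := ⟨pp.2⟩; placeOf (pilotDataOfK D K) pp.1 x₀ ∈ (pilotDataOfK D K).S) :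
    (if (pp : ℕ) = 2 then 2 else 1 : ℕ) = 1 := by
  rw [if_neg (ne_two_and_ne_l_of_placeOf_mem_S_pilotDataOfK D pp x₀ hx).1]

/-! ## §2. The cells for the CHOSEN realising q-idele -/

/-- **DECIDED-POS cell (every `e`).** With `e = e(K_w/ℚ_p)`, `m = ord_w(q)/(2l)`, `t = e − m·(n−1)`: if `e < t·(p−1)` then
`q ∈ qⁿ·ℐ_w` for the chosen realising q-idele at the bad fibre point `x₀` — `p·q^{1−n}` lies in the SHARP inner ball `𝔪_w^{⌊e/(p−1)⌋+1} ⊆ log_p(𝒪^×_{K_w})`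
(`ValuationProfile.mem_pow_smul_logShell_of_lt`).  For `n = j²` this is «`(j²−1)·m + ⌊e/(p−1)⌋ + 1 ≤ e`», STRONGER than [IUTchIV] Prop. 1.2 (i)'s
`κ⁻`-test. [cite: NeukirchANT1999, Ch. II Prop. (5.5)] [cite: MochizukiAbsTopIII2015, Def 5.4 (iii) p. 126] -/
theorem chosenQIdele_mem_pow_smul_logShell_of_lt (pp : Nat.Primes) (x₀ : (thetaIndex (pilotDataOfK D K)).Fibre (.inr pp))
    (hx : haveI : Fact (pp : ℕ).Prime := ⟨pp.2⟩; placeOf (pilotDataOfK D K) pp.1 x₀ ∈ (pilotDataOfK D K).S) (n : ℕ)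
    (h : haveI : Fact (pp : ℕ).Prime := ⟨pp.2⟩
      (absRamificationIdx (pp : ℕ) (kOf (pilotDataOfK D K) pp.1 x₀) : ℤ) <
        ((absRamificationIdx (pp : ℕ) (kOf (pilotDataOfK D K) pp.1 x₀) : ℤ) -
          (pilotDataOfK D K).ordq (placeOf (pilotDataOfK D K) pp.1 x₀) / (2 * (l : ℤ)) * ((n : ℤ) - 1)) * (((pp : ℕ) : ℤ) - 1)) :
    haveI : Fact (pp : ℕ).Prime := ⟨pp.2⟩
    (exists_realising_qIdeles_pilotDataOfK D).choose pp x₀ ∈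
      (exists_realising_qIdeles_pilotDataOfK D).choose pp x₀ ^ n •
        Literature.AnabelianGeometry.AbsoluteAnabelian.logShell (PadicLogOnUnits.ofUnitLog (pp : ℕ) (kOf (pilotDataOfK D K) pp.1 x₀)) := by
  haveI : Fact (pp : ℕ).Prime := ⟨pp.2⟩
  obtain ⟨ϖ, hϖ⟩ := exists_isUniformizer (F := kOf (pilotDataOfK D K) pp.1 x₀)
  refine mem_pow_smul_logShell_of_lt (pp : ℕ) hϖ ((exists_realising_qIdeles_pilotDataOfK D).choose_spec.1 pp x₀)
    (norm_chosenQIdele_eq_unif_zpow D pp x₀ hx hϖ) ?_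
  rw [pstar_exponent_eq_one D pp x₀ hx]
  simpa using h

/-- **DECIDED-NEG cell, gap form (`(p−1) ∤ e`).** If `t = e − m·(n−1)` lies in a GAP of the valuation profile of `log_p(𝒪^×_{K_w})` — i.e.
`s·p^{a₀} − e·a₀ < t < (s+1)·p^{a₁} − e·a₁` for some `s ≥ 1`, any `a₀`, and `a₁` the turning point of `s+1` (`(s+1)·pᵃ·(p−1) < e` for `a < a₁`,
`e ≤ (s+1)·p^{a₁}·(p−1)`) — then `q ∉ qⁿ·ℐ_w` for the chosen realising q-idele (`ValuationProfile.not_mem_pow_smul_logShell_of_gap`).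
The table writer supplies `(s, a₀, a₁)`; all hypotheses are integer inequalities. [cite: NeukirchANT1999, Ch. II Prop. (5.5)] -/
theorem chosenQIdele_not_mem_pow_smul_logShell_of_gap (pp : Nat.Primes) (x₀ : (thetaIndex (pilotDataOfK D K)).Fibre (.inr pp))
    (hx : haveI : Fact (pp : ℕ).Prime := ⟨pp.2⟩; placeOf (pilotDataOfK D K) pp.1 x₀ ∈ (pilotDataOfK D K).S)
    (hnd : haveI : Fact (pp : ℕ).Prime := ⟨pp.2⟩; ¬ ((pp : ℕ) - 1) ∣ absRamificationIdx (pp : ℕ) (kOf (pilotDataOfK D K) pp.1 x₀))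
    (n : ℕ) {s : ℤ} (hs : 1 ≤ s) {a₀ a₁ : ℕ}
    (h1 : haveI : Fact (pp : ℕ).Prime := ⟨pp.2⟩
      s * ((pp : ℕ) : ℤ) ^ a₀ - (absRamificationIdx (pp : ℕ) (kOf (pilotDataOfK D K) pp.1 x₀) : ℤ) * (a₀ : ℤ) <
        (absRamificationIdx (pp : ℕ) (kOf (pilotDataOfK D K) pp.1 x₀) : ℤ) -
          (pilotDataOfK D K).ordq (placeOf (pilotDataOfK D K) pp.1 x₀) / (2 * (l : ℤ)) * ((n : ℤ) - 1))
    (hlo₁ : haveI : Fact (pp : ℕ).Prime := ⟨pp.2⟩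
      ∀ a < a₁, (s + 1) * ((pp : ℕ) : ℤ) ^ a * (((pp : ℕ) : ℤ) - 1) < absRamificationIdx (pp : ℕ) (kOf (pilotDataOfK D K) pp.1 x₀))
    (hhi₁ : haveI : Fact (pp : ℕ).Prime := ⟨pp.2⟩
      (absRamificationIdx (pp : ℕ) (kOf (pilotDataOfK D K) pp.1 x₀) : ℤ) ≤ (s + 1) * ((pp : ℕ) : ℤ) ^ a₁ * (((pp : ℕ) : ℤ) - 1))
    (h2 : haveI : Fact (pp : ℕ).Prime := ⟨pp.2⟩
      (absRamificationIdx (pp : ℕ) (kOf (pilotDataOfK D K) pp.1 x₀) : ℤ) -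
          (pilotDataOfK D K).ordq (placeOf (pilotDataOfK D K) pp.1 x₀) / (2 * (l : ℤ)) * ((n : ℤ) - 1) <
        (s + 1) * ((pp : ℕ) : ℤ) ^ a₁ - (absRamificationIdx (pp : ℕ) (kOf (pilotDataOfK D K) pp.1 x₀) : ℤ) * (a₁ : ℤ)) :
    haveI : Fact (pp : ℕ).Prime := ⟨pp.2⟩
    (exists_realising_qIdeles_pilotDataOfK D).choose pp x₀ ∉
      (exists_realising_qIdeles_pilotDataOfK D).choose pp x₀ ^ n •
        Literature.AnabelianGeometry.AbsoluteAnabelian.logShell (PadicLogOnUnits.ofUnitLog (pp : ℕ) (kOf (pilotDataOfK D K) pp.1 x₀)) := by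
  haveI : Fact (pp : ℕ).Prime := ⟨pp.2⟩
  obtain ⟨ϖ, hϖ⟩ := exists_isUniformizer (F := kOf (pilotDataOfK D K) pp.1 x₀)
  refine not_mem_pow_smul_logShell_of_gap (pp : ℕ) hnd hϖ ((exists_realising_qIdeles_pilotDataOfK D).choose_spec.1 pp x₀)
    (norm_chosenQIdele_eq_unif_zpow D pp x₀ hx hϖ) hs (a₀ := a₀) (a₁ := a₁) ?_ hlo₁ hhi₁ ?_
  · rw [pstar_exponent_eq_one D pp x₀ hx]; simpa using h1
  · rw [pstar_exponent_eq_one D pp x₀ hx]; simpa using h2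

/-- **DECIDED-NEG cell, floor form (every `e`).** With `a₀` the turning point of `s = 1` (`pᵃ·(p−1) < e` for `a < a₀`, `e ≤ p^{a₀}·(p−1)`):
if `t = e − m·(n−1) < p^{a₀} − e·a₀` (the MINIMUM valuation of `log_p(𝒪^×_{K_w})`, abc-iut-f-167) then `q ∉ qⁿ·ℐ_w` — the sharp form of
[IUTchIV] Prop. 1.2 (i)'s `κ⁺`-test. [cite: NeukirchANT1999, Ch. II Prop. (5.5)] -/
theorem chosenQIdele_not_mem_pow_smul_logShell_of_lt_min (pp : Nat.Primes) (x₀ : (thetaIndex (pilotDataOfK D K)).Fibre (.inr pp))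
    (hx : haveI : Fact (pp : ℕ).Prime := ⟨pp.2⟩; placeOf (pilotDataOfK D K) pp.1 x₀ ∈ (pilotDataOfK D K).S) (n : ℕ) {a₀ : ℕ}
    (hlo : haveI : Fact (pp : ℕ).Prime := ⟨pp.2⟩
      ∀ a < a₀, (1 : ℤ) * ((pp : ℕ) : ℤ) ^ a * (((pp : ℕ) : ℤ) - 1) < absRamificationIdx (pp : ℕ) (kOf (pilotDataOfK D K) pp.1 x₀))
    (hhi : haveI : Fact (pp : ℕ).Prime := ⟨pp.2⟩
      (absRamificationIdx (pp : ℕ) (kOf (pilotDataOfK D K) pp.1 x₀) : ℤ) ≤ 1 * ((pp : ℕ) : ℤ) ^ a₀ * (((pp : ℕ) : ℤ) - 1))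
    (h : haveI : Fact (pp : ℕ).Prime := ⟨pp.2⟩
      (absRamificationIdx (pp : ℕ) (kOf (pilotDataOfK D K) pp.1 x₀) : ℤ) -
          (pilotDataOfK D K).ordq (placeOf (pilotDataOfK D K) pp.1 x₀) / (2 * (l : ℤ)) * ((n : ℤ) - 1) <
        1 * ((pp : ℕ) : ℤ) ^ a₀ - (absRamificationIdx (pp : ℕ) (kOf (pilotDataOfK D K) pp.1 x₀) : ℤ) * (a₀ : ℤ)) :
    haveI : Fact (pp : ℕ).Prime := ⟨pp.2⟩
    (exists_realising_qIdeles_pilotDataOfK D).choose pp x₀ ∉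
      (exists_realising_qIdeles_pilotDataOfK D).choose pp x₀ ^ n •
        Literature.AnabelianGeometry.AbsoluteAnabelian.logShell (PadicLogOnUnits.ofUnitLog (pp : ℕ) (kOf (pilotDataOfK D K) pp.1 x₀)) := by
  haveI : Fact (pp : ℕ).Prime := ⟨pp.2⟩
  obtain ⟨ϖ, hϖ⟩ := exists_isUniformizer (F := kOf (pilotDataOfK D K) pp.1 x₀)
  refine not_mem_pow_smul_logShell_of_lt_min (pp : ℕ) hϖ ((exists_realising_qIdeles_pilotDataOfK D).choose_spec.1 pp x₀)
    (norm_chosenQIdele_eq_unif_zpow D pp x₀ hx hϖ) hlo hhi ?_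
  rw [pstar_exponent_eq_one D pp x₀ hx]; simpa using h

/-- **SHAPE-OPEN cells are HONESTLY OPEN (`(p−1) ∤ e`).** At an exponent `t = ν(s) = s·p^{a₀} − e·a₀` with `s ≥ 1`, `a₀ ≥ 1` and `a₀` the
STRICT turning point of `s` in `K_w`: the sphere `{‖z‖ = ‖ϖ‖ᵗ}` of `K_w` CONTAINS a log-unit and is NOT contained in `log_p(𝒪^×_{K_w})`
(`ValuationProfile.sphere_meets_not_subset_logUnits`) — so when `p·q^{1−n}` has this norm, NEITHER cell verdict follows from the norm of the
chosen idele alone (the realising ideles are specified by their norms only).  Finer data of the true `q̲_w = q_E^{1/2l}` would be needed.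
[cite: NeukirchANT1999, Ch. II Prop. (5.5)] -/
theorem shapeOpen_witnesses (pp : Nat.Primes) (x₀ : (thetaIndex (pilotDataOfK D K)).Fibre (.inr pp))
    (hnd : haveI : Fact (pp : ℕ).Prime := ⟨pp.2⟩; ¬ ((pp : ℕ) - 1) ∣ absRamificationIdx (pp : ℕ) (kOf (pilotDataOfK D K) pp.1 x₀))
    {ϖ : (haveI : Fact (pp : ℕ).Prime := ⟨pp.2⟩; kOf (pilotDataOfK D K) pp.1 x₀)ˣ}
    (hϖ : haveI : Fact (pp : ℕ).Prime := ⟨pp.2⟩; IsUniformizer ϖ) {s : ℕ} (hs : 1 ≤ s) {a₀ : ℕ} (ha₀ : a₀ ≠ 0)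
    (hlo : haveI : Fact (pp : ℕ).Prime := ⟨pp.2⟩
      ∀ a < a₀, (s : ℤ) * ((pp : ℕ) : ℤ) ^ a * (((pp : ℕ) : ℤ) - 1) < absRamificationIdx (pp : ℕ) (kOf (pilotDataOfK D K) pp.1 x₀))
    (hhi : haveI : Fact (pp : ℕ).Prime := ⟨pp.2⟩
      (absRamificationIdx (pp : ℕ) (kOf (pilotDataOfK D K) pp.1 x₀) : ℤ) < (s : ℤ) * ((pp : ℕ) : ℤ) ^ a₀ * (((pp : ℕ) : ℤ) - 1)) :
    haveI : Fact (pp : ℕ).Prime := ⟨pp.2⟩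
    (∃ z ∈ logUnits (kOf (pilotDataOfK D K) pp.1 x₀),
        ‖z‖ = ‖(ϖ : kOf (pilotDataOfK D K) pp.1 x₀)‖ ^
          ((s : ℤ) * ((pp : ℕ) : ℤ) ^ a₀ - (absRamificationIdx (pp : ℕ) (kOf (pilotDataOfK D K) pp.1 x₀) : ℤ) * (a₀ : ℤ))) ∧
      ¬ {z : kOf (pilotDataOfK D K) pp.1 x₀ | ‖z‖ = ‖(ϖ : kOf (pilotDataOfK D K) pp.1 x₀)‖ ^
          ((s : ℤ) * ((pp : ℕ) : ℤ) ^ a₀ - (absRamificationIdx (pp : ℕ) (kOf (pilotDataOfK D K) pp.1 x₀) : ℤ) * (a₀ : ℤ))}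
        ⊆ logUnits (kOf (pilotDataOfK D K) pp.1 x₀) := by
  haveI : Fact (pp : ℕ).Prime := ⟨pp.2⟩
  exact sphere_meets_not_subset_logUnits (pp : ℕ) hnd hϖ hs ha₀ hlo hhi

/-! ## §3. The stratum row (type column of the R-H table) -/

/-- **Every row of the `pilotDataOfK` family is «ram-odd, `l ∣ e`-deep».** At a bad fibre point `x₀ ∣ p` of `X = pilotDataOfK D K`:
`p ≠ 2`, `p ≠ l` ([IUTchI] Def. 3.1 (b)(c); abc-iut-w5-d054), `l ≤ e(K_w/ℚ_p)` (abc-iut-w4-d026; indeed `l ∣ e`), `2l ∣ ord_w(q)` (Ex. 3.2 (iv);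
abc-iut-C-cert-3) and `p ∣ disc K` (the «unram-odd» case A is VOID: abc-iut-w5-d054 `caseA_hypotheses_unsat_pilotDataOfK`).  So the R-H strata
«unram-odd», «v ∣ 2», «v ∣ l» are EMPTY on this family and `c = 1` throughout. [cite: Mochizuki2012, IUTchI Def. 3.1 (b)(c) pp. 61–62, Ex. 3.2 (iv) p. 71] -/
theorem stratum_row (pp : Nat.Primes) (x₀ : (thetaIndex (pilotDataOfK D K)).Fibre (.inr pp))
    (hx : haveI : Fact (pp : ℕ).Prime := ⟨pp.2⟩; placeOf (pilotDataOfK D K) pp.1 x₀ ∈ (pilotDataOfK D K).S) :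
    haveI : Fact (pp : ℕ).Prime := ⟨pp.2⟩
    (pp : ℕ) ≠ 2 ∧ (pp : ℕ) ≠ l ∧ l ≤ absRamificationIdx (pp : ℕ) (kOf (pilotDataOfK D K) pp.1 x₀) ∧
      (2 * (l : ℤ)) ∣ (pilotDataOfK D K).ordq (placeOf (pilotDataOfK D K) pp.1 x₀) ∧
      ((pp : ℕ) : ℤ) ∣ NumberField.discr K := by
  haveI : Fact (pp : ℕ).Prime := ⟨pp.2⟩
  refine ⟨(ne_two_and_ne_l_of_placeOf_mem_S_pilotDataOfK D pp x₀ hx).1, (ne_two_and_ne_l_of_placeOf_mem_S_pilotDataOfK D pp x₀ hx).2,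
    l_le_absRamificationIdx_kOf_pilotDataOfK D pp x₀ hx, two_mul_l_dvd_ordq_placeOf D pp x₀ hx, ?_⟩
  by_contra hdisc
  exact caseA_hypotheses_unsat_pilotDataOfK D pp x₀ ⟨hdisc, hx⟩

end Summit.ABC.IUTFork.Repair.EvalI06StarShape

end
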